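import Summits.CriticalPhenomena.PercolationContinuityZ3.Theorems.FK.RadiusDecayRate
import Summits.CriticalPhenomena.PercolationContinuityZ3.Theorems.FK.BoxLimitComparison
import Literature.Probability.Percolation.LocalLimitConnections
import HarnessLib

/-!
# FK-continuity cell, FO-10a: the inverse correlation length `ψ^b(p,q)` of `φ^b_{p,q}` is NON-INCREASING in `p`,
# NON-DECREASING in `q`, and `ψ¹ ≤ ψ⁰` (Grimmett 2006, §5.5: "By the comparison inequality, Proposition 4.28,
# L(p,q) is non-decreasing in p" — the same comparison for the rate of (5.56))

Registered R120 (cell INBOX l.7682, 2026-08-25); registry row FO-10a-g343m; label CRM-A (coordinator fk-4 g231).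
Cell `fk-continuity` (bschramm), row FO-10a; support file for the FK-continuity transplant
(`--supports stmt-CriticalPhenomena-4575`); builds on p205010 (kernel theorem, internal audit signed; external expert
review pending). Companion of `RadiusDecayRate.lean` (Thm. (5.44) / Cor. (5.45): `ψ^b(p,q) = lim -n⁻¹ log φ^b_{p,q}(0 ↔ ∂Λ_n)`
exists and equals the axis two-point rate). Pure proofs; no definitions, no named facts, no sorries. UNCONDITIONAL;
decides nothing about the VALUE of `ψ` anywhere (in particular not Conjecture (5.54)).

The radius law `φ^b_{p,q}(0 ↔ ∂Λ_n)` is the probability of an increasing LOCAL event, so the comparison inequalities of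
Prop. (4.28)(a) (the tree's `IsBoxLimit.real_mono_left` / `real_anti_right`, `BoxLimitComparison.lean`) and the
free/wired comparison `φ⁰ ≤ φ¹` (Lemma (4.14)(b), the tree's `rcLimit_real_false_le_true`) order the radius laws
term by term; `-n⁻¹ log` reverses the order and the limits of `RadiusDecayRate.lean` inherit it:
`p ≤ p' ⇒ ψ^b(p',q) ≤ ψ^b(p,q)`, `1 ≤ q' ≤ q ⇒ ψ^b(p,q') ≤ ψ^b(p,q)`, `ψ¹(p,q) ≤ ψ⁰(p,q)`.

## Contents (namespace `Summit.CriticalPhenomena.PercolationContinuityZ3.Theorems.FK`)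

* `le_of_tendsto_neg_log_div_of_le` — real analysis: `0 < a_n ≤ b_n`, `-n⁻¹ log a_n → α`, `-n⁻¹ log b_n → β` give
  `β ≤ α`;
* `rcLimit_real_siteToBoundary_mono_left` / `…_anti_right` / `rcLimit_real_siteToBoundary_false_le_true` /
  `rcLimit_real_siteToBoundary_pos` — the radius laws are ordered in `p`, `q`, `b` and positive for `p > 0`;
* **`radiusDecayRate_rcLimit_anti_left`**, **`radiusDecayRate_rcLimit_mono_right`**,
  **`radiusDecayRate_rcLimit_true_le_false`** — the rates (given as the limits they are) are ordered accordingly;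
* `exists_radiusDecayRate_rcLimit_le_of_le` — the `∃`-form for `p ≤ p'` read together with `RadiusDecayRate.lean`;
* `decayRate_rcLimit_axis_eq` — the axis two-point rates along `e_k`, `e_{k'}` coincide (both are the radius rate).

## References

* G. Grimmett, *The Random-Cluster Model*, Springer 2006, §5.5 (5.56)–(5.58) (monotonicity of the radius law in `p`
  by Prop. (4.28)), Prop. (4.28)(a), Lemma (4.14)(b), Cor. (5.45). [Grimmett2006]
-/

noncomputable section

open MeasureTheory Set Filter
open scoped Topology

namespace Summit.CriticalPhenomena.PercolationContinuityZ3.Theorems.FK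

open Literature.Probability.Percolation Literature.Probability.LatticeModels

variable {d : ℕ}

/-- If `0 < a_n ≤ b_n` for all `n`, `-n⁻¹ log a_n → α` and `-n⁻¹ log b_n → β`, then `β ≤ α`. [folklore] -/
theorem le_of_tendsto_neg_log_div_of_le {a b : ℕ → ℝ} {α β : ℝ} (hpos : ∀ n, 0 < a n) (hle : ∀ n, a n ≤ b n)
    (ha : Tendsto (fun n : ℕ => -Real.log (a n) / n) atTop (𝓝 α))
    (hb : Tendsto (fun n : ℕ => -Real.log (b n) / n) atTop (𝓝 β)) : β ≤ α :=
  le_of_tendsto_of_tendsto' hb ha fun n =>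
    div_le_div_of_nonneg_right (neg_le_neg (Real.log_le_log (hpos n) (hle n))) n.cast_nonneg

/-- The radius law is non-decreasing in `p`: `φ^b_{p,q}(0 ↔ ∂Λ_n) ≤ φ^b_{p',q}(0 ↔ ∂Λ_n)` for `p ≤ p'` (`q ≥ 1`).
[cite: Grimmett2006, Prop. (4.28)(a); §5.5 (5.57)] -/
theorem rcLimit_real_siteToBoundary_mono_left (b : Bool) {p p' q : ℝ} (hp : p ∈ Set.Icc (0 : ℝ) 1)
    (hp' : p' ∈ Set.Icc (0 : ℝ) 1) (hpp' : p ≤ p') (hq : 1 ≤ q) (n : ℕ) :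
    (rcLimit d b p q).real (siteToBoundary d n) ≤ (rcLimit d b p' q).real (siteToBoundary d n) := by
  obtain ⟨K, hK⟩ := isLocalEvent_siteToBoundary d n
  exact (isBoxLimit_rcLimit b hp hq).real_mono_left (isBoxLimit_rcLimit b hp' hq) hp hp' hpp' hq
    (DCT16.isUpperSet_siteToBoundary d n) hK

/-- The radius law is non-increasing in `q`: `φ^b_{p,q}(0 ↔ ∂Λ_n) ≤ φ^b_{p,q'}(0 ↔ ∂Λ_n)` for `1 ≤ q' ≤ q`.
[cite: Grimmett2006, Prop. (4.28)(a)] -/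
theorem rcLimit_real_siteToBoundary_anti_right (b : Bool) {p q q' : ℝ} (hp : p ∈ Set.Icc (0 : ℝ) 1)
    (hq' : 1 ≤ q') (hqq' : q' ≤ q) (n : ℕ) :
    (rcLimit d b p q).real (siteToBoundary d n) ≤ (rcLimit d b p q').real (siteToBoundary d n) := by
  obtain ⟨K, hK⟩ := isLocalEvent_siteToBoundary d n
  exact (isBoxLimit_rcLimit b hp (hq'.trans hqq')).real_anti_right (isBoxLimit_rcLimit b hp hq') hp hq' hqq'
    (DCT16.isUpperSet_siteToBoundary d n) hK

/-- The free radius law is below the wired one: `φ⁰_{p,q}(0 ↔ ∂Λ_n) ≤ φ¹_{p,q}(0 ↔ ∂Λ_n)` (`0 ≤ p ≤ 1`, `q ≥ 1`).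
[cite: Grimmett2006, Lemma (4.14)(b), Thm. (4.19)(a)] -/
theorem rcLimit_real_siteToBoundary_false_le_true {p q : ℝ} (hp : p ∈ Set.Icc (0 : ℝ) 1) (hq : 1 ≤ q) (n : ℕ) :
    (rcLimit d false p q).real (siteToBoundary d n) ≤ (rcLimit d true p q).real (siteToBoundary d n) :=
  rcLimit_real_false_le_true hp hq (isLocalEvent_siteToBoundary d n) (DCT16.isUpperSet_siteToBoundary d n)

/-- The radius law is positive for `p > 0` (`d ≥ 1`): `0 < φ^b_{p,q}(0 ↔ ∂Λ_n)` (it dominates `φ^b(0 ↔ (n+1)e_k) > 0`).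
[cite: Grimmett2006, Thm. (4.17)(a) (finite energy)] -/
theorem rcLimit_real_siteToBoundary_pos (b : Bool) {p q : ℝ} (hp : p ∈ Set.Ioc (0 : ℝ) 1) (hq : 1 ≤ q) (k : Fin d)
    (n : ℕ) : 0 < (rcLimit d b p q).real (siteToBoundary d n) := by
  have hp' : p ∈ Set.Icc (0 : ℝ) 1 := ⟨hp.1.le, hp.2⟩
  haveI := (isBoxLimit_rcLimit (d := d) b hp' hq).isProbabilityMeasure
  exact ((isBoxLimit_rcLimit b hp' hq).real_openConn_pos hp hq 0 _).trans_le
    (real_openConn_le_real_siteToBoundary_of_notMem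
      ((isBoxLimit_rcLimit b hp' hq).ae_subset_edgeSet hp' (one_pos.trans_le hq))
      (succ_nsmul_single_one_notMem_box k n))

/-- **`ψ^b(p',q) ≤ ψ^b(p,q)` for `p ≤ p'`** (`0 < p`, `q ≥ 1`, `d ≥ 1`): the radius decay rate — given, for each of the
two parameter values, as the limit `-n⁻¹ log φ^b(0 ↔ ∂Λ_n) → ψ` which `RadiusDecayRate.lean` provides — is
NON-INCREASING in `p`. [cite: Grimmett2006, §5.5 (5.56)–(5.57) with Prop. (4.28)(a)] -/
theorem radiusDecayRate_rcLimit_anti_left (b : Bool) {p p' q : ℝ} (hp : p ∈ Set.Ioc (0 : ℝ) 1)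
    (hp' : p' ∈ Set.Icc (0 : ℝ) 1) (hpp' : p ≤ p') (hq : 1 ≤ q) (k : Fin d) {ψ ψ' : ℝ}
    (hψ : Tendsto (fun n : ℕ => -Real.log ((rcLimit d b p q).real (siteToBoundary d n)) / n) atTop (𝓝 ψ))
    (hψ' : Tendsto (fun n : ℕ => -Real.log ((rcLimit d b p' q).real (siteToBoundary d n)) / n) atTop (𝓝 ψ')) :
    ψ' ≤ ψ :=
  le_of_tendsto_neg_log_div_of_le (rcLimit_real_siteToBoundary_pos b hp hq k)
    (rcLimit_real_siteToBoundary_mono_left b ⟨hp.1.le, hp.2⟩ hp' hpp' hq) hψ hψ'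

/-- **`ψ^b(p,q') ≤ ψ^b(p,q)` for `1 ≤ q' ≤ q`** (`0 < p`, `d ≥ 1`): the radius decay rate is NON-DECREASING in `q`.
[cite: Grimmett2006, Prop. (4.28)(a) with Cor. (5.45)] -/
theorem radiusDecayRate_rcLimit_mono_right (b : Bool) {p q q' : ℝ} (hp : p ∈ Set.Ioc (0 : ℝ) 1) (hq' : 1 ≤ q')
    (hqq' : q' ≤ q) (k : Fin d) {ψ ψ' : ℝ}
    (hψ : Tendsto (fun n : ℕ => -Real.log ((rcLimit d b p q).real (siteToBoundary d n)) / n) atTop (𝓝 ψ))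
    (hψ' : Tendsto (fun n : ℕ => -Real.log ((rcLimit d b p q').real (siteToBoundary d n)) / n) atTop (𝓝 ψ')) :
    ψ' ≤ ψ :=
  le_of_tendsto_neg_log_div_of_le (rcLimit_real_siteToBoundary_pos b hp (hq'.trans hqq') k)
    (rcLimit_real_siteToBoundary_anti_right b ⟨hp.1.le, hp.2⟩ hq' hqq') hψ hψ'

/-- **`ψ¹(p,q) ≤ ψ⁰(p,q)`** (`0 < p ≤ 1`, `q ≥ 1`, `d ≥ 1`): the wired radius law dominates the free one, so the wired
rate is the smaller. [cite: Grimmett2006, Lemma (4.14)(b) with Cor. (5.45)] -/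
theorem radiusDecayRate_rcLimit_true_le_false {p q : ℝ} (hp : p ∈ Set.Ioc (0 : ℝ) 1) (hq : 1 ≤ q) (k : Fin d)
    {ψ₀ ψ₁ : ℝ}
    (hψ₀ : Tendsto (fun n : ℕ => -Real.log ((rcLimit d false p q).real (siteToBoundary d n)) / n) atTop (𝓝 ψ₀))
    (hψ₁ : Tendsto (fun n : ℕ => -Real.log ((rcLimit d true p q).real (siteToBoundary d n)) / n) atTop (𝓝 ψ₁)) :
    ψ₁ ≤ ψ₀ :=
  le_of_tendsto_neg_log_div_of_le (rcLimit_real_siteToBoundary_pos false hp hq k)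
    (rcLimit_real_siteToBoundary_false_le_true ⟨hp.1.le, hp.2⟩ hq) hψ₀ hψ₁

/-- **`∃`-form, monotonicity in `p`**: for `0 < p ≤ p' ≤ 1`, `q ≥ 1`, `d ≥ 1`, the radius rates `ψ^b(p,q)`,
`ψ^b(p',q)` of Cor. (5.45) exist and satisfy `ψ^b(p',q) ≤ ψ^b(p,q)`.
[cite: Grimmett2006, Cor. (5.45), §5.5 (5.56)–(5.57)] -/
theorem exists_radiusDecayRate_rcLimit_le_of_le (b : Bool) {p p' q : ℝ} (hp : p ∈ Set.Ioc (0 : ℝ) 1)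
    (hp' : p' ∈ Set.Ioc (0 : ℝ) 1) (hpp' : p ≤ p') (hq : 1 ≤ q) (k : Fin d) :
    ∃ ψ ψ' : ℝ,
      Tendsto (fun n : ℕ => -Real.log ((rcLimit d b p q).real (siteToBoundary d n)) / n) atTop (𝓝 ψ) ∧
      Tendsto (fun n : ℕ => -Real.log ((rcLimit d b p' q).real (siteToBoundary d n)) / n) atTop (𝓝 ψ') ∧
      0 ≤ ψ' ∧ ψ' ≤ ψ := by
  obtain ⟨ψ, -, -, hψ, -, -⟩ := exists_radiusDecayRate_rcLimit (d := d) b hp hq k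
  obtain ⟨ψ', hψ'0, -, hψ', -, -⟩ := exists_radiusDecayRate_rcLimit (d := d) b hp' hq k
  exact ⟨ψ, ψ', hψ, hψ', hψ'0, radiusDecayRate_rcLimit_anti_left b hp ⟨hp'.1.le, hp'.2⟩ hpp' hq k hψ hψ'⟩

/-- **The axis two-point rates all coincide** (`0 < p ≤ 1`, `q ≥ 1`, `d ≥ 1`): if `-n⁻¹ log φ^b_{p,q}(0 ↔ n e_k) → ψ`
and `-n⁻¹ log φ^b_{p,q}(0 ↔ n e_{k'}) → ψ'` then `ψ = ψ'` — both equal the radius rate of `RadiusDecayRate.lean`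
(uniqueness of limits). [cite: Grimmett2006, Thm. (5.44) (ν = ψ is direction-free)] -/
theorem decayRate_rcLimit_axis_eq (b : Bool) {p q : ℝ} (hp : p ∈ Set.Ioc (0 : ℝ) 1) (hq : 1 ≤ q) (k k' : Fin d)
    {ψ ψ' : ℝ}
    (hψ : Tendsto (fun n : ℕ =>
      -Real.log ((rcLimit d b p q).real (openConn (0 : Site d) (n • (Pi.single k (1 : ℤ) : Site d)))) / n)
      atTop (𝓝 ψ))
    (hψ' : Tendsto (fun n : ℕ =>
      -Real.log ((rcLimit d b p q).real (openConn (0 : Site d) (n • (Pi.single k' (1 : ℤ) : Site d)))) / n)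
      atTop (𝓝 ψ')) :
    ψ = ψ' := by
  obtain ⟨χ, -, hχA, hχR, -, -⟩ := exists_radiusDecayRate_rcLimit (d := d) b hp hq k
  obtain ⟨χ', -, hχ'A, hχ'R, -, -⟩ := exists_radiusDecayRate_rcLimit (d := d) b hp hq k'
  rw [tendsto_nhds_unique hψ hχA, tendsto_nhds_unique hψ' hχ'A, tendsto_nhds_unique hχR hχ'R]

end Summit.CriticalPhenomena.PercolationContinuityZ3.Theorems.FK

end
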